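import Literature.RepresentationTheory.TwistedCoinvariantsCompactFixedLift
import Literature.NumberTheory.Automorphic.SmoothRepresentation
import Literature.NumberTheory.Automorphic.UnitaryGroupDualPairLocalLine
import Literature.NumberTheory.Automorphic.Liu2021.Def411WeilCarriers
import Literature.NumberTheory.Automorphic.Liu2021.Def411WeilCarriersIrreducibleOfLemD1
import Literature.NumberTheory.GelbartRogawski1991.LocalLineModelTransport
import Literature.NumberTheory.GelbartRogawski1991.LocalLeraySection
import Literature.NumberTheory.GelbartRogawski1991.UnitaryDualPairThetaKernelCM
import Literature.NumberTheory.QuadraticForms.HilbertSymbolAtUnramifiedPlace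
import HarnessLib

/-!
# FLOOR-0 P2 — ROAD δ, file δ3 (local lemmas): the spherical-line lift, the implementer bridge and the norm-class dictionary behind
# stub NSI of `Cruxes/H413/Lines/F0_P2PKRung3.lean` (crux item stmt-HodgeConjecture-24833 `HCCMUnconditional.H413`)

Cell hodgecm-mathlib (D-0151), FLOOR 0, programme P2; ROAD δ (director s484, F0P2-p01 (g4) CUT 2026-08-31T05:50Z; spec `F0/P2/ROAD-DELTA-spec.F0P2p01g4.md`
§Files δ3 (i)–(ii)); seat B-p18 (g24).  THEOREMS ONLY (no `def`, no instance, no notation, no named fact, no `sorry`); imports no `Cruxes/…/Lines` module.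
Consumed by `Theorems/F0P2gStubNSIOfCore.lean` (NSI modulo (CORE′)) and the closer `Theorems/F0P2gStubNSINontrivialClassNotSpherical.lean`.

* §2 (generic dual pair `U(J_V) × U(J_W)` over `E/F`, `J_W` a line, ANY restricted family of local splittings `𝓢 : FinLocalSplittings`, ANY character `χ₁`
  of the centre `U(J_W)(F_v)`): `mem_localInt_of_localLineInl_mem` (converse of ★ `localLineInl_mapsTo_localInt`); `isSmooth_omegaLoc_comp_localLineInl`;
  **`exists_ne_zero_fixed_of_isSpherical_coinv`** — a `U(J_V)(𝒪_v)`-spherical line of the `χ₁`-coinvariant quotient of `ω_v` (restricted along `k ↦ k ⊗ 1`)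
  lifts to a NON-ZERO Schwartz–Bruhat function FIXED by every `ω_v(u ⊗ 1)`, `u ∈ U(J_V)(𝒪_v)` (★ `TwistedCoinv.exists_ne_zero_mem_fixedPoints_of_ne_bot`,
  p812544: `K`-fixed points are exact along the compact open ★ `isOpen_localInt` ∕ `isCompact_localInt`, the action smooth by ★ `continuous_localLineInl`);
  **`forall_implementer_eigen_of_fixed`** — such a function is an EIGENVECTOR of EVERY implementer `M` of `ι_v(k)`, `k ∈ U(J_V ⊗ J_W)(𝒪_v)` (`k = u ⊗ 1` by
  ★ `localLineInl_surjective`; `ω_v(k)` implements `ι_v(k)` by `proj_s`; implementers differ by scalars ★ `implementerUniqueUpToScalar_localSchrodinger`).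
* §3 the local norm class `locF F d a v ∈ F_vˣ ∕ N(F_v(√d)ˣ)` of [Liu2021, Def. 4.12]: `locF_apply_eq_one_iff` (definitional); `locF_apply_eq_one_of_isSquare`
  (★ `quadraticNormSubgroup_eq_top_of_isSquare`); **`locF_apply_eq_one_iff_even`** ∕ `odd_log_valued_of_locF_apply_ne_one` at an unramified inert place
  (★ `mem_quadraticNormSubgroup_iff_even_of_isUnramifiedIn` = O'Meara 63:16); the CM instance `F = L⁺`, `E = L`, `α = δ = imagUnit L`, `d = δ²`
  (`imagUnit_sq`, `algebraMap_ne_imagUnit`, **`odd_log_valued_of_locF_ne_one`**, **`locF_eq_one_of_isSquare`**).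

`--kind proof --supports stmt-HodgeConjecture-24833 --as helper`.  HONEST LABEL: nothing printed is discharged here; HC_CM is proved only modulo the printed
citations until rung 0 closes.

## References
* [BernsteinZelevinsky1976] I. N. Bernstein, A. V. Zelevinsky, Russian Math. Surveys 31 (1976): §2.1–2.3 (exactness of `K`-fixed vectors, `K` compact open).
* [MoeglinVignerasWaldspurger1987] C. Mœglin, M.-F. Vignéras, J.-L. Waldspurger, LNM 1291 (1987): Chap. 2 II.1 (A) (implementers, unique up to scalars).
* [PlatonovRapinchuk1994] V. Platonov, A. Rapinchuk, *Algebraic Groups and Number Theory* (1994): §5.1 (`G_{𝒪_v}`).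
* [Omeara1963] O. T. O'Meara, *Introduction to Quadratic Forms* (1963): §63C Example 63:16, §63B 63:13a, §65A.
* [Liu2021] Y. Liu, Camb. J. Math. 9 (2021) = arXiv:2102.11518: Def. 4.11–4.12 (l. 2083–2108), App. D §D.1.
-/

set_option autoImplicit false
-- the mandated namespace has the single-problem summit's repeated segment (`HodgeConjecture.HodgeConjecture`)
set_option linter.dupNamespace false

noncomputable section

open NumberField MeasureTheory IsDedekindDomain Set
open scoped Matrix Kronecker ComplexOrder NNReal

namespace Summit.HodgeConjecture.HodgeConjecture.Cruxes.H413.F0P2gStubNSILocalLemmas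

open Literature.NumberTheory Literature.NumberTheory.Automorphic Literature.NumberTheory.Automorphic.UnitaryGroup
open Literature.NumberTheory.Automorphic.IdeleClassGroup
open Literature.NumberTheory.Automorphic.Liu2021 Literature.NumberTheory.Automorphic.Liu2021.Def411WeilCarriers
open Literature.NumberTheory.GelbartRogawski1991 Literature.NumberTheory.GelbartRogawski1991.UnitaryDualPair
open Literature.NumberTheory.GelbartRogawski1991.UnitaryDualPair.WeilCoinv
open Literature.NumberTheory.GelbartRogawski1991.UnitaryDualPair.LocalSplitting
open Literature.NumberTheory.QuadraticForms
open Literature.NumberTheory.GaloisRepresentations.IsNonarchimedeanLocalField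
open Literature.RepresentationTheory Literature.RepresentationTheory.Liu2021 Literature.RepresentationTheory.HeisenbergGroup

/-! ## §2 Generic: a spherical line of the central coinvariant quotient gives a non-zero `U(J_V)(𝒪_v)`-fixed Schwartz–Bruhat
function, which is an eigenvector of every implementer of `ι_v(k)`, `k ∈ U(J_{VW})(𝒪_v)` -/

section Generic

variable (F E : Type) [Field F] [NumberField F] [Field E] [NumberField E] [Algebra F E]
variable (c : E ≃ₐ[F] E) (N : ℕ) {n : ℕ} (e : Fin N × Fin 1 ≃ Fin n)
variable (JV : Matrix (Fin N) (Fin N) E) (JW : Matrix (Fin 1) (Fin 1) E)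

/-- **converse of ★ `localLineInl_mapsTo_localInt`**: if `k ⊗ 1 ∈ U(J_V ⊗ J_W)(𝒪_v)` then `k ∈ U(J_V)(𝒪_v)` (the entries of
`k_w` and `k_w⁻¹` are entries of `reindex e (k_w ⊗ 1)` and `reindex e (k_w⁻¹ ⊗ 1)`). [cite: PlatonovRapinchuk1994, §5.1] -/
theorem mem_localInt_of_localLineInl_mem (v : HeightOneSpectrum (𝓞 F)) (k : localPi E c N JV v)
    (hk : localLineInl E c N e JV JW v k ∈ localInt E c n (Matrix.reindex e e (JV ⊗ₖ JW)) v) :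
    k ∈ localInt E c N JV v := by
  rw [mem_localInt_iff] at hk ⊢
  intro w
  obtain ⟨h1, h2⟩ := (mem_glInt_iff _).1 (hk w)
  rw [coe_localLineInl] at h1 h2
  rw [mem_glInt_iff]
  refine ⟨fun i j => ?_, fun i j => ?_⟩
  · have h := h1 (e (i, 0)) (e (j, 0))
    rwa [coe_localLineGL_apply, Matrix.reindex_apply, Matrix.submatrix_apply, Equiv.symm_apply_apply,
      Equiv.symm_apply_apply, Matrix.kroneckerMap_apply, Matrix.one_apply_eq, mul_one] at h
  · have h := h2 (e (i, 0)) (e (j, 0))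
    rwa [coe_localLineGL_apply_inv, Matrix.reindex_apply, Matrix.submatrix_apply, Equiv.symm_apply_apply,
      Equiv.symm_apply_apply, Matrix.kroneckerMap_apply, Matrix.one_apply_eq, mul_one] at h

variable {TV : Matrix (Fin N) (Fin N) F} {TW : Matrix (Fin 1) (Fin 1) F}
variable [Algebra.IsQuadraticExtension F E] {δ : E} (hcδ : c δ = -δ) (hδ : δ ≠ 0) {d : F}
  (hd : δ * δ = algebraMap F E d) (hV : TV.IsSymm) (hW : TW.IsSymm)
  (hJV : JV = TV.map (algebraMap F E)) (hJW : JW = TW.map (algebraMap F E)) (hJW0 : JW 0 0 ≠ 0)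
  (𝓢 : LocalSplitting.FinLocalSplittings F E c n hcδ hδ hd (gram F e TV TW) (isSymm_gram F e hV hW)
    (reindex_kronecker_eq_gram_map F E e hJV hJW))

/-- `ω_v ∘ (k ↦ k ⊗ 1)` is smooth (`ω_v` smooth, `k ↦ k ⊗ 1` continuous ★ `continuous_localLineInl`).
[cite: BernsteinZelevinsky1976, Definition 2.1] -/
theorem isSmooth_omegaLoc_comp_localLineInl (v : HeightOneSpectrum (𝓞 F)) :
    Representation.IsSmooth ((𝓢.omegaLoc v).comp (localLineInl E c N e JV JW v)) :=
  fun Φ => (𝓢.isSmooth_omegaLoc v Φ).preimage (continuous_localLineInl F E c N JV v e JW)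

/-- **a `U(J_V)(𝒪_v)`-spherical line of the central `χ_{1,v}`-coinvariant quotient of `ω_v` (restricted along `k ↦ k ⊗ 1`)
lifts to a NON-ZERO `U(J_V)(𝒪_v)`-FIXED Schwartz–Bruhat function** (★ `TwistedCoinv.exists_ne_zero_mem_fixedPoints_of_ne_bot`
at the compact open `U(J_V)(𝒪_v)` ★ `isOpen_localInt`∕`isCompact_localInt`, the smooth `ω_v ∘ (k ↦ k ⊗ 1)`).
[cite: BernsteinZelevinsky1976, §2.3] -/
theorem exists_ne_zero_fixed_of_isSpherical_coinv (v : HeightOneSpectrum (𝓞 F)) (χ₁ : localPi E c 1 JW v →* ℂˣ)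
    (hsph : Representation.IsSpherical
      ((show Representation ℂ (localPi E c N JV v) _ from
        (TwistedCoinv.rep χ₁ (𝓢.omegaLoc v) (commute_omegaLoc_localCenter F E c N e JV JW hcδ hδ hd hV hW hJV hJW hJW0 𝓢 v)).comp
          (localLineInl E c N e JV JW v)))
      (localInt E c N JV v)) :
    ∃ f : SchwartzBruhat (Fin n → v.adicCompletion F), f ≠ 0 ∧
      ∀ u ∈ localInt E c N JV v, 𝓢.omegaLoc v (localLineInl E c N e JV JW v u) f = f := by
  have hne := hsph.isUnramified
  rw [Representation.isUnramified_iff] at hne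
  have hc' : ∀ (g : localPi E c N JV v) (h : localPi E c 1 JW v),
      Commute (((𝓢.omegaLoc v).comp (localLineInl E c N e JV JW v)) g)
        ((show Representation ℂ (localPi E c 1 JW v) _ from
          (𝓢.omegaLoc v).comp (localCenter E c n (Matrix.reindex e e (JV ⊗ₖ JW)) JW hJW0 v)) h) :=
    fun g h => commute_omegaLoc_localCenter F E c N e JV JW hcδ hδ hd hV hW hJV hJW hJW0 𝓢 v (localLineInl E c N e JV JW v g) h
  have hrep : (show Representation ℂ (localPi E c N JV v) _ from
        (TwistedCoinv.rep χ₁ (𝓢.omegaLoc v) (commute_omegaLoc_localCenter F E c N e JV JW hcδ hδ hd hV hW hJV hJW hJW0 𝓢 v)).comp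
          (localLineInl E c N e JV JW v)) =
      TwistedCoinv.rep χ₁ ((𝓢.omegaLoc v).comp (localLineInl E c N e JV JW v)) hc' :=
    MonoidHom.ext fun _ => rfl
  rw [hrep] at hne
  exact TwistedCoinv.exists_ne_zero_mem_fixedPoints_of_ne_bot _ χ₁ _ hc'
    (isSmooth_omegaLoc_comp_localLineInl F E c N e JV JW hcδ hδ hd hV hW hJV hJW 𝓢 v) (localInt E c N JV v)
    (isOpen_localInt E c N JV v) (isCompact_localInt E c N JV v) hne

include hJW0 in
/-- **the implementer bridge**: a Schwartz–Bruhat function FIXED by `ω_v(u ⊗ 1)` for all `u ∈ U(J_V)(𝒪_v)` is an EIGENVECTOR of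
EVERY implementer `M` of `ι_v(k)` for every `k ∈ U(J_V ⊗ J_W)(𝒪_v)`: `k = u ⊗ 1` with `u` integral (★ `localLineInl_surjective`,
`mem_localInt_of_localLineInl_mem`), `ω_v(k)` implements `ι_v(k)` (the field `proj_s`), and implementers of one symplectic element
differ by a scalar (★ `implementerUniqueUpToScalar_localSchrodinger`). [cite: MoeglinVignerasWaldspurger1987, Chap. 2 II.1 (A)] -/
theorem forall_implementer_eigen_of_fixed (hVd : IsUnit TV.det) (hWd : IsUnit TW.det) (v : HeightOneSpectrum (𝓞 F))
    (f : SchwartzBruhat (Fin n → v.adicCompletion F))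
    (hf : ∀ u ∈ localInt E c N JV v, 𝓢.omegaLoc v (localLineInl E c N e JV JW v u) f = f)
    (k : localPi E c n (Matrix.reindex e e (JV ⊗ₖ JW)) v) (hk : k ∈ localInt E c n (Matrix.reindex e e (JV ⊗ₖ JW)) v)
    (M : SchwartzBruhat (Fin n → v.adicCompletion F) ≃ₗ[ℂ] SchwartzBruhat (Fin n → v.adicCompletion F))
    (hM : (iota F E c n hcδ hδ hd (gram F e TV TW) (isSymm_gram F e hV hW) (reindex_kronecker_eq_gram_map F E e hJV hJW) v k, M) ∈
      MpPsi (localSchrodinger F n (gram F e TV TW) v)) :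
    ∃ κ : ℂ, M f = κ • f := by
  obtain ⟨u, rfl⟩ := localLineInl_surjective E c N e JV JW hJW0 v k
  have hu : u ∈ localInt E c N JV v := mem_localInt_of_localLineInl_mem F E c N e JV JW v u hk
  -- `ω_v(k)` implements `ι_v(k)`
  have h₁ : Implements (localSchrodinger F n (gram F e TV TW) v)
      (ofSymplectic _ (iota F E c n hcδ hδ hd (gram F e TV TW) (isSymm_gram F e hV hW)
        (reindex_kronecker_eq_gram_map F E e hJV hJW) v (localLineInl E c N e JV JW v u)))
      (((𝓢.s v (localLineInl E c N e JV JW v u) : LocalMp F n (gram F e TV TW) v) : LocalSp F n (gram F e TV TW) v ×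
        (SchwartzBruhat (Fin n → v.adicCompletion F) ≃ₗ[ℂ] SchwartzBruhat (Fin n → v.adicCompletion F))).2) := by
    have hmem := (mem_MpPsi (localSchrodinger F n (gram F e TV TW) v) _).1 (𝓢.s v (localLineInl E c N e JV JW v u)).2
    rwa [𝓢.fst_s v] at hmem
  have h₂ : Implements (localSchrodinger F n (gram F e TV TW) v)
      (ofSymplectic _ (iota F E c n hcδ hδ hd (gram F e TV TW) (isSymm_gram F e hV hW)
        (reindex_kronecker_eq_gram_map F E e hJV hJW) v (localLineInl E c N e JV JW v u))) M :=
    (mem_MpPsi (localSchrodinger F n (gram F e TV TW) v) _).1 hM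
  obtain ⟨κ, hκ⟩ := implementerUniqueUpToScalar_localSchrodinger F n (gram F e TV TW) (isUnit_det_gram F e hVd hWd) v _ _ _ h₁ h₂
  refine ⟨(κ : ℂ), ?_⟩
  rw [hκ f, ← 𝓢.omegaLoc_apply v, hf u hu]

end Generic

/-! ## §3 The local norm class of a global line: trivial at split places, parity of the order at unramified inert places -/

section NormClass

variable (F : Type) [Field F] [NumberField F] (d : F)

/-- `[a]_v = 1` in `F_vˣ ⧸ N(F_v(√d)ˣ)` iff `a` is a local norm at `v`. [cite: Liu2021, Def. 4.12 (l. 2105)] -/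
theorem locF_apply_eq_one_iff (a : Fˣ) (v : HeightOneSpectrum (𝓞 F)) :
    locF F d a v = 1 ↔
      Units.map (algebraMap F (v.adicCompletion F)).toMonoidHom a ∈
        quadraticNormSubgroup (v.adicCompletion F) (algebraMap F (v.adicCompletion F) d) := by
  rw [locF_apply, QuotientGroup.eq_one_iff]

/-- **at a place where `d` is a square (a SPLIT place) every class is trivial**: `[a]_v = 1` for every `a ∈ F^×`
(★ `quadraticNormSubgroup_eq_top_of_isSquare`). [cite: Omeara1963, §63 (split case)] -/
theorem locF_apply_eq_one_of_isSquare {d} (hd0 : d ≠ 0) {v : HeightOneSpectrum (𝓞 F)}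
    (hsq : IsSquare (algebraMap F (v.adicCompletion F) d)) (a : Fˣ) : locF F d a v = 1 := by
  haveI : CharZero (v.adicCompletion F) := charZero_of_injective_algebraMap (algebraMap F _).injective
  haveI : NeZero (2 : v.adicCompletion F) := ⟨two_ne_zero⟩
  rw [locF_apply_eq_one_iff,
    quadraticNormSubgroup_eq_top_of_isSquare hsq ((map_ne_zero (algebraMap F (v.adicCompletion F))).2 hd0)]
  exact Subgroup.mem_top _

variable {F d} {E : Type*} [Field E] [NumberField E] [Algebra F E] [Algebra.IsQuadraticExtension F E] {α : E}

/-- **at an unramified INERT place the class of `a` is the parity of its order**: for `E = F(α)`, `α² = d`, `α ∉ F`, `v`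
unramified in `E` with `d ∉ F_v²`: `[a]_v = 1 ↔ ord_v a` even (★ `mem_quadraticNormSubgroup_iff_even_of_isUnramifiedIn`,
O'Meara 63:16). [cite: Omeara1963, §63C Example 63:16] -/
theorem locF_apply_eq_one_iff_even (hα : α ^ 2 = algebraMap F E d) (hαF : ∀ r : F, algebraMap F E r ≠ α)
    {v : HeightOneSpectrum (𝓞 F)} (hunr : Algebra.IsUnramifiedIn (𝓞 E) v.asIdeal)
    (hnsq : ¬ IsSquare (algebraMap F (v.adicCompletion F) d)) (a : Fˣ) :
    locF F d a v = 1 ↔ Even (WithZero.log (Valued.v (algebraMap F (v.adicCompletion F) (a : F)))) := by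
  rw [locF_apply_eq_one_iff, mem_quadraticNormSubgroup_iff_even_of_isUnramifiedIn hα hαF hunr hnsq]
  rfl

/-- contrapositive form used by the NSI closer: at an unramified inert place, a NON-trivial class has ODD order.
[cite: Omeara1963, §63C Example 63:16] -/
theorem odd_log_valued_of_locF_apply_ne_one (hα : α ^ 2 = algebraMap F E d) (hαF : ∀ r : F, algebraMap F E r ≠ α)
    {v : HeightOneSpectrum (𝓞 F)} (hunr : Algebra.IsUnramifiedIn (𝓞 E) v.asIdeal)
    (hnsq : ¬ IsSquare (algebraMap F (v.adicCompletion F) d)) {a : Fˣ} (ha : locF F d a v ≠ 1) :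
    Odd (WithZero.log (Valued.v (algebraMap F (v.adicCompletion F) (a : F)))) := by
  rw [Ne, locF_apply_eq_one_iff_even hα hαF hunr hnsq] at ha
  exact Int.not_even_iff_odd.1 ha

end NormClass

/-! ### The CM instance: `F = L⁺`, `E = L`, `α = δ = imagUnit L`, `d = δ² = imagUnitSq L` -/

section CM

variable (L : Type) [Field L] [NumberField L] [IsCMField L]

/-- `δ² = imagUnitSq L` read as `δ ^ 2`. [folklore] -/
theorem imagUnit_sq : imagUnit L ^ 2 = algebraMap (↥(maximalRealSubfield L)) L (imagUnitSq L) := by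
  rw [sq, imagUnit_mul_self]

/-- `δ ∉ L⁺` (it is moved by complex conjugation). [folklore] -/
theorem algebraMap_ne_imagUnit (r : ↥(maximalRealSubfield L)) :
    algebraMap (↥(maximalRealSubfield L)) L r ≠ imagUnit L := by
  intro h
  have hfix : IsCMField.complexConj L (imagUnit L) = imagUnit L := by
    rw [← h]
    exact (IsCMField.complexConj_eq_self_iff (K := L) _).2 r.2
  rw [complexConj_imagUnit] at hfix
  exact imagUnit_ne_zero L (by linear_combination (-(1:L)/2) * hfix)

/-- **NSI's norm-class dictionary at an unramified inert place of `L/L⁺`**: `locF L⁺ δ² ε v ≠ 1 ⇒ ord_v ε` odd.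
[cite: Omeara1963, §63C Example 63:16] -/
theorem odd_log_valued_of_locF_ne_one {v : HeightOneSpectrum (𝓞 ↥(maximalRealSubfield L))}
    (hunr : Algebra.IsUnramifiedIn (𝓞 L) v.asIdeal)
    (hnsq : ¬ IsSquare (algebraMap (↥(maximalRealSubfield L)) (v.adicCompletion ↥(maximalRealSubfield L)) (imagUnitSq L)))
    {ε : (↥(maximalRealSubfield L))ˣ} (hε : locF (↥(maximalRealSubfield L)) (imagUnitSq L) ε v ≠ 1) :
    Odd (WithZero.log (Valued.v (algebraMap (↥(maximalRealSubfield L)) (v.adicCompletion ↥(maximalRealSubfield L))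
      (ε : ↥(maximalRealSubfield L))))) :=
  odd_log_valued_of_locF_apply_ne_one (imagUnit_sq L) (algebraMap_ne_imagUnit L) hunr hnsq hε

/-- **… and at a split place every class is trivial**: `δ²` a square in `L⁺_v ⇒ locF L⁺ δ² ε v = 1`.
[cite: Omeara1963, §63 (split case)] -/
theorem locF_eq_one_of_isSquare {v : HeightOneSpectrum (𝓞 ↥(maximalRealSubfield L))}
    (hsq : IsSquare (algebraMap (↥(maximalRealSubfield L)) (v.adicCompletion ↥(maximalRealSubfield L)) (imagUnitSq L)))
    (ε : (↥(maximalRealSubfield L))ˣ) : locF (↥(maximalRealSubfield L)) (imagUnitSq L) ε v = 1 :=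
  locF_apply_eq_one_of_isSquare (↥(maximalRealSubfield L)) (fun h => imagUnit_ne_zero L (by
    have := imagUnit_mul_self L; rw [h, map_zero, mul_self_eq_zero] at this; exact this)) hsq ε

end CM




end Summit.HodgeConjecture.HodgeConjecture.Cruxes.H413.F0P2gStubNSILocalLemmas

end
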